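import Mathlib
import Summits.Ventures.HodgeRepro.CMType
import Summits.Ventures.HodgeRepro.HodgeSets
import Summits.Ventures.HodgeRepro.CMRank
import Summits.Ventures.HodgeRepro.Groups
import Summits.Ventures.HodgeRepro.Primitive
import Summits.Ventures.HodgeRepro.MuTable
import Summits.Ventures.HodgeRepro.MuDecide
import Summits.Ventures.HodgeRepro.MuWeightsTransport
import Summits.Ventures.HodgeRepro.MuPairs
import Summits.Ventures.HodgeRepro.MuPairsRank
import Summits.Ventures.HodgeRepro.MuPairsCensusGen
import Summits.Ventures.HodgeRepro.RankCertZ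
import Summits.Ventures.HodgeRepro.RankCensus8a
import Summits.Ventures.HodgeRepro.RankCensus8b

/-! # The pairs theorem across the census: degree 8 (all five groups, all central involutions) (seat p2; see `MuPairsCensusGen.lean`). -/

set_option autoImplicit false

open Finset
open scoped Pointwise

namespace HodgeRepro

/-! ### Degree 8 -/

/-- `C8`: every Hodge set of every CM type is a union of antipodal pairs. -/
theorem isPairUnion_C8 {Φ : Finset C8} (hΦ : IsCMType cc_C8 Φ) {Δ : Finset C8}
    (hΔ : IsHodgeSet cc_C8 Φ Δ) : IsPairUnion Φ Δ :=
  isPairUnion_of_cover cc_C8_isComplexConj reps_C8 ranks_C8 (by decide) cmRank_reps_C8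
    (by decide) (by decide) (fun _ h => isCMType_C8_cover h) hΦ hΔ

/-- `C4 × C2`, square involution: every Hodge set of every CM type is a union of antipodal pairs. -/
theorem isPairUnion_C4xC2_sq {Φ : Finset C4xC2} (hΦ : IsCMType cc_C4xC2_sq Φ) {Δ : Finset C4xC2}
    (hΔ : IsHodgeSet cc_C4xC2_sq Φ Δ) : IsPairUnion Φ Δ :=
  isPairUnion_of_cover cc_C4xC2_sq_isComplexConj reps_C4xC2_sq ranks_C4xC2_sq (by decide)
    cmRank_reps_C4xC2_sq (by decide) (by decide) (fun _ h => isCMType_C4xC2_sq_cover h) hΦ hΔ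

/-- `C4 × C2`, first non-square involution: every Hodge set of every CM type is a union of antipodal pairs. -/
theorem isPairUnion_C4xC2_ns {Φ : Finset C4xC2} (hΦ : IsCMType cc_C4xC2_ns Φ) {Δ : Finset C4xC2}
    (hΔ : IsHodgeSet cc_C4xC2_ns Φ Δ) : IsPairUnion Φ Δ :=
  isPairUnion_of_cover cc_C4xC2_ns_isComplexConj reps_C4xC2_ns ranks_C4xC2_ns (by decide)
    cmRank_reps_C4xC2_ns (by decide) (by decide) (fun _ h => isCMType_C4xC2_ns_cover h) hΦ hΔ

/-- `C4 × C2`, second non-square involution: every Hodge set of every CM type is a union of antipodal pairs. -/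
theorem isPairUnion_C4xC2_ns' {Φ : Finset C4xC2} (hΦ : IsCMType cc_C4xC2_ns' Φ) {Δ : Finset C4xC2}
    (hΔ : IsHodgeSet cc_C4xC2_ns' Φ Δ) : IsPairUnion Φ Δ :=
  isPairUnion_of_cover cc_C4xC2_ns'_isComplexConj reps_C4xC2_nsp ranks_C4xC2_nsp (by decide)
    cmRank_reps_C4xC2_nsp (by decide) (by decide) (fun _ h => isCMType_C4xC2_nsp_cover h) hΦ hΔ

/-- `C2 × C2 × C2`: every Hodge set of every CM type is a union of antipodal pairs. -/
theorem isPairUnion_C2xC2xC2 {Φ : Finset C2xC2xC2} (hΦ : IsCMType cc_C2xC2xC2 Φ) {Δ : Finset C2xC2xC2}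
    (hΔ : IsHodgeSet cc_C2xC2xC2 Φ Δ) : IsPairUnion Φ Δ :=
  isPairUnion_of_cover cc_C2xC2xC2_isComplexConj reps_C2xC2xC2 ranks_C2xC2xC2 (by decide)
    cmRank_reps_C2xC2xC2 (by decide) (by decide) (fun _ h => isCMType_C2xC2xC2_cover h) hΦ hΔ

/-- `D4`: every Hodge set of every CM type is a union of antipodal pairs. -/
theorem isPairUnion_D4 {Φ : Finset D4} (hΦ : IsCMType cc_D4 Φ) {Δ : Finset D4}
    (hΔ : IsHodgeSet cc_D4 Φ Δ) : IsPairUnion Φ Δ :=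
  isPairUnion_of_cover cc_D4_isComplexConj reps_D4 ranks_D4 (by decide) cmRank_reps_D4
    (by decide) (by decide) (fun _ h => isCMType_D4_cover h) hΦ hΔ

/-- `Q8`: every Hodge set of every CM type is a union of antipodal pairs. -/
theorem isPairUnion_Q8 {Φ : Finset Q8} (hΦ : IsCMType cc_Q8 Φ) {Δ : Finset Q8}
    (hΔ : IsHodgeSet cc_Q8 Φ Δ) : IsPairUnion Φ Δ :=
  isPairUnion_of_cover cc_Q8_isComplexConj reps_Q8 ranks_Q8 (by decide) cmRank_reps_Q8
    (by decide) (by decide) (fun _ h => isCMType_Q8_cover h) hΦ hΔ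

end HodgeRepro
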